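import Summits.BirchSwinnertonDyer.BirchSwinnertonDyer.Theses.ResidualThetaTransportAtTwo
import Summits.BirchSwinnertonDyer.BirchSwinnertonDyer.Theorems.ResidualThetaTransportAtTwoSemilinearH1
import HarnessLib

/-!
# Sketch (crux-ideate #1, r1 g5) — card C1 `gl1-plus-selmer-jlk-basechange`, NEW First lemma(s):
# clause (S) at `v ∣ 2` of the lead's global transfer package (LAMBDA-INEQ-g10 §5/§6), typed over EXISTING declarations.

Target crux: `(R≥)ᵖ` `…Theses.ResidualThetaTransportAtTwo.ResidualThetaCountLowerPureAtTwo` (stmt-BirchSwinnertonDyer-26074).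
Props only (no theorem, no sorry). `E'` is pinned to `ℚ₄ = ℚ₂(ζ₃)` by `finrank = 2 ∧ ∃ z, z²+z+1 = 0` over the crux's own
local field `v.adicCompletion ℚ` (`2 ∈ v`); the plus points over the `ℚ₄`-tower `ℚ₄·ℚ_n` are the TREE's
`Kobayashi2003.signedLocalPointsOfEmb κ ι' W 1 n` for an embedding `ι' : ℚ̄ → ℚ̄₄'` (generic in the completion field), and the local
condition is the TREE's `Kobayashi2003.localKummerOverOfEmb`. BSD / no summit statement is proved by this seat.
-/

set_option autoImplicit false
set_option linter.dupNamespace false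

noncomputable section

namespace Summit.BirchSwinnertonDyer.BirchSwinnertonDyer.Cruxes.ResidualThetaCountLowerPureAtTwo.SketchC1g5

open Literature
open NumberTheory.EllipticCurves Kobayashi2003 GreenbergVatsal2000 Rank1Residual GreenbergSelmer IsDedekindDomain NumberField
  AddSubgroup Field
open Summit.BirchSwinnertonDyer.BirchSwinnertonDyer.Theorems.ResidualLayer

/-- **(S-res) at `2`, core — LOCAL PLUS-KUMMER DESCENT ALONG `ℚ₄/ℚ₂` (card C1, stub K1).**
For `W/ℚ` supersingular at `2` with `a₂ = 0`, `κ` a `ℤ₂`-extension of `ℚ` (the cyclotomic one), `v ∣ 2`, `E' ≅ ℚ₄` over `ℚ_v`,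
`j : ℚ̄_v → ℚ̄'` over `ℚ_v` and `ι' = j ∘ closureEmb`: a class `c ∈ H¹(ℚ_∞, W[2^∞])` satisfies the crux's plus-Kummer condition at the
place of `ℚ_∞` above `2` (plus points over Kobayashi's tower `F_n = ℚ_{2,n}`) IFF it satisfies the plus-Kummer condition over the
`ℚ₄`-tower `ℚ₄·F_n` (restriction to `Gal(ℚ̄'/ℚ₄ℚ_{2,∞})`). `→` is functoriality; `←` is étale `ℤ₄ = ℤ₂[ζ₃]`-descent: the plus
formal-group points over `ℚ₄F_n` are an INDUCED `Gal(ℚ₄/ℚ₂)`-module (`Ŵ ⊗ ℤ₄ = LT(−2,4)`, lead p609616/p614843; semilinear descent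
p611163), so the index-`2 = p` obstruction `H¹(Gal(ℚ₄/ℚ₂), E⁺ ⊗ ℚ₂/ℤ₂)` vanishes, and `W(ℚ₄ℚ_{2,∞})[2] = 0` (`3 ∣ e(ℚ₂(W[2])/ℚ₂)`). -/
def LocalPlusKummerDescentAtTwo : Prop :=
  ∀ (W : WeierstrassCurve ℚ) [W.IsElliptic] [W.IsGloballyMinimal], GoodSS W 2 → W.frobeniusTrace 2 = 0 →
  ∀ (κ : ZpExtension ℚ 2) (v : HeightOneSpectrum (𝓞 ℚ)), ((2 : ℕ) : 𝓞 ℚ) ∈ v.asIdeal →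
  ∀ (E' : Type) [Field E'] [CharZero E'] [Algebra (v.adicCompletion ℚ) E'],
    Module.finrank (v.adicCompletion ℚ) E' = 2 → (∃ z : E', z ^ 2 + z + 1 = 0) →
  ∀ (j : AlgebraicClosure (v.adicCompletion ℚ) →ₐ[v.adicCompletion ℚ] AlgebraicClosure E')
    (ι' : AlgebraicClosure ℚ →ₐ[ℚ] AlgebraicClosure E'),
    (∀ x, ι' x = j (closureEmb (K := ℚ) (v.adicCompletion ℚ) x)) →
  ∀ c : W.subgroupH1 2 κ.kerSubgroup,
    c ∈ localKummerOverOfEmb W 2 κ.kerSubgroup (closureEmb (K := ℚ) (v.adicCompletion ℚ))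
        (⨆ n : ℕ, signedLocalPoints κ (v.adicCompletion ℚ) W 1 n) ↔
    c ∈ localKummerOverOfEmb W 2 κ.kerSubgroup ι' (⨆ n : ℕ, signedLocalPointsOfEmb κ ι' W 1 n)

/-- **(S-ω) at `2` — the plus-Kummer condition over the `ℚ₄`-tower is `ω`-STABLE (card C1, stub K1ω).**
`N ⊴ Γ_ℚ` any normal subgroup, `e` an endomorphism of `V = (W[2^∞])[2]` commuting with `Γ_{ℚ_∞} ∩ N` and with `e² + e + 1 = 0`
(so `e ∈ {[ζ₃], [ζ₃]²}|_V`), `ω = H¹(e)` (lead p620184 `resH1Hom id e`): if the push-forward of `y ∈ H¹(Γ_{ℚ_∞} ∩ N, V)` to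
`W[2^∞]` satisfies the plus-Kummer condition over `ℚ₄·F_n` at `ι'`, so does that of `ω y`. Content: the `ℤ₄`-module structure
`[ζ₃]` of `Ŵ ⊗ ℤ₄ = LT(−2,4)` preserves `Ê⁺(ℚ₄F_n)` (it commutes with the traces of `Gal(ℚ̄'/ℚ₄)`), restricts to `e^{±1}` on `V`,
and the Kummer map on formal points is `ℤ₄`-linear (RELATIVE-LT-g9 §2 carrier dictionary = the one missing definition-level input). -/
def LocalPlusKummerOmegaStableAtTwo : Prop :=
  ∀ (W : WeierstrassCurve ℚ) [W.IsElliptic] [W.IsGloballyMinimal], GoodSS W 2 → W.frobeniusTrace 2 = 0 →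
  ∀ (κ : ZpExtension ℚ 2) (v : HeightOneSpectrum (𝓞 ℚ)), ((2 : ℕ) : 𝓞 ℚ) ∈ v.asIdeal →
  ∀ (E' : Type) [Field E'] [CharZero E'] [Algebra (v.adicCompletion ℚ) E'],
    Module.finrank (v.adicCompletion ℚ) E' = 2 → (∃ z : E', z ^ 2 + z + 1 = 0) →
  ∀ (ι' : AlgebraicClosure ℚ →ₐ[ℚ] AlgebraicClosure E') (N : Subgroup (absoluteGaloisGroup ℚ)) [N.Normal]
    (e : ↥(torsionBy ↥(W.geomPrimaryTorsion 2) (2 : ℤ)) →+ ↥(torsionBy ↥(W.geomPrimaryTorsion 2) (2 : ℤ)))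
    (he : ∀ (a : ↥(κ.kerSubgroup ⊓ N)) (m : ↥(torsionBy ↥(W.geomPrimaryTorsion 2) (2 : ℤ))),
      e ((a : absoluteGaloisGroup ℚ) • m) = (a : absoluteGaloisGroup ℚ) • e m),
    (∀ m : ↥(torsionBy ↥(W.geomPrimaryTorsion 2) (2 : ℤ)), e (e m) + e m + m = 0) →
  ∀ y : subgroupH1 (κ.kerSubgroup ⊓ N) ↥(torsionBy ↥(W.geomPrimaryTorsion 2) (2 : ℤ)),
    pushH1 (κ.kerSubgroup ⊓ N) (torsionBy ↥(W.geomPrimaryTorsion 2) (2 : ℤ)).subtype (fun _ _ ↦ rfl) y ∈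
      localKummerOverOfEmb W 2 (κ.kerSubgroup ⊓ N) ι' (⨆ n : ℕ, signedLocalPointsOfEmb κ ι' W 1 n) →
    pushH1 (κ.kerSubgroup ⊓ N) (torsionBy ↥(W.geomPrimaryTorsion 2) (2 : ℤ)).subtype (fun _ _ ↦ rfl)
        (resH1Hom (ContinuousMonoidHom.id ↥(κ.kerSubgroup ⊓ N)) e (endo_compat (κ.kerSubgroup ⊓ N) e he) y) ∈
      localKummerOverOfEmb W 2 (κ.kerSubgroup ⊓ N) ι' (⨆ n : ℕ, signedLocalPointsOfEmb κ ι' W 1 n)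

/-- **(S-res) at `2`, glue — the Kummer condition at `ι'` is insensitive to shrinking `H` to `H ⊓ N` when the decomposition group
`res_{ι'}(Γ_{E'})` lies in `N`** (formal: `localSubgroupOfEmb (H ⊓ N) ι'` and `localSubgroupOfEmb H ι'` have the same image in
`Γ_{E'}` and the Kummer cocycle restricts). Generic `W/K`, `p`, `H`, `N`. Support-sized. -/
def LocalKummerResOfLeInfIff : Prop :=
  ∀ (W : WeierstrassCurve ℚ) (p : ℕ) (H N : Subgroup (absoluteGaloisGroup ℚ))
    (E' : Type) [Field E'] [CharZero E'] (ι' : AlgebraicClosure ℚ →ₐ[ℚ] AlgebraicClosure E')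
    (A' : AddSubgroup (localPoints W E')),
    (∀ τ : absoluteGaloisGroup E', resGalOfEmb ι' τ ∈ N) →
  ∀ c : W.subgroupH1 p H,
    c ∈ localKummerOverOfEmb W p H ι' A' ↔
      W.resOfLe p (inf_le_left : H ⊓ N ≤ H) c ∈ localKummerOverOfEmb W p (H ⊓ N) ι' A'

/-- **(λT)_W — THE W-CURRENCY RESIDUAL TRANSFER IDENTITY AT `2` (card C1, stubs K1+K1ω+K1c+(S-c), composed with the lead's
capstone p621177 `natCard_eq_sq_natCard_comap_resOfLe`).** For a habitat curve (`GoodSS W 2`, `a₂ = 0`, `Δ < 0`), `κ` the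
`ℤ₂`-extension, `S₀ ∌ 2` containing the bad places, `N = ρ̄⁻¹(A₃)` the even subgroup (typed `permGal`-free: `σ ∈ N ↔ σ³` acts
trivially on `V = (W[2^∞])[2]`, equivalent to the lead's `sign (permGal W h2 σ) = 1` since `GL₂(𝔽₂) ≅ S₃`), `E' ≅ ℚ₄` over `ℚ_v`
(`v ∣ 2`) and ANY `ι' : ℚ̄ → ℚ̄'`: the square of the crux's counted number `#R⁺_{S₀}(W[2]/ℚ_∞)` (its set verbatim) equals the number
of classes of `H¹(Γ_{ℚ_∞} ∩ N, V)` unramified outside `S₀ ∪ {2}` whose every conjugate satisfies the plus-Kummer condition over the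
`ℚ₄`-tower at `ι'`. No archimedean clause on the right (vacuous on the left by p617001 since `Δ < 0`). `0 ^ 2 = 0` covers the
infinite case, so no finiteness binder (PUB-G / GZK) is needed. This is the whole TRANSPORT half of the C1 line in `W`-currency;
what remains K-side is to COUNT the right-hand set by the `GL₁` plus main conjecture for `φ` (memo C1-LINE-SPEC §3, K3–K5). -/
def ResidualPlusTransferCountAtTwo : Prop :=
  ∀ (W : WeierstrassCurve ℚ) [W.IsElliptic] [W.IsGloballyMinimal], GoodSS W 2 → W.frobeniusTrace 2 = 0 → W.Δ < 0 →
  ∀ (κ : ZpExtension ℚ 2) (S₀ : Finset (HeightOneSpectrum (𝓞 ℚ))),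
    (∀ v ∈ S₀, ((2 : ℕ) : 𝓞 ℚ) ∉ v.asIdeal) → (∀ v : HeightOneSpectrum (𝓞 ℚ), ¬ W.HasGoodReductionAt v → v ∈ S₀) →
  ∀ (N : Subgroup (absoluteGaloisGroup ℚ)) [N.Normal],
    (∀ σ : absoluteGaloisGroup ℚ, σ ∈ N ↔ ∀ m : ↥(torsionBy ↥(W.geomPrimaryTorsion 2) (2 : ℤ)), σ • σ • σ • m = m) →
  ∀ (v : HeightOneSpectrum (𝓞 ℚ)), ((2 : ℕ) : 𝓞 ℚ) ∈ v.asIdeal →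
  ∀ (E' : Type) [Field E'] [CharZero E'] [Algebra (v.adicCompletion ℚ) E'],
    Module.finrank (v.adicCompletion ℚ) E' = 2 → (∃ z : E', z ^ 2 + z + 1 = 0) →
  ∀ (ι' : AlgebraicClosure ℚ →ₐ[ℚ] AlgebraicClosure E'),
  {x : subgroupH1 κ.kerSubgroup ↥(torsionBy ↥(W.geomPrimaryTorsion 2) (2 : ℤ)) |
      x ∈ unramifiedOutside κ.kerSubgroup ↥(torsionBy ↥(W.geomPrimaryTorsion 2) (2 : ℤ)) 2
            (↑S₀ : Set (HeightOneSpectrum (𝓞 ℚ))) ∧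
      (∀ (w : InfinitePlace ℚ) (σ : absoluteGaloisGroup ℚ),
        conjH1 κ.kerSubgroup ↥(torsionBy ↥(W.geomPrimaryTorsion 2) (2 : ℤ)) σ x ∈
          infKer κ.kerSubgroup ↥(torsionBy ↥(W.geomPrimaryTorsion 2) (2 : ℤ)) w) ∧
      (∀ (v : HeightOneSpectrum (𝓞 ℚ)), ((2 : ℕ) : 𝓞 ℚ) ∈ v.asIdeal → ∀ σ : absoluteGaloisGroup ℚ,
        W.conjH1 2 κ.kerSubgroup σ
          (pushH1 κ.kerSubgroup (torsionBy ↥(W.geomPrimaryTorsion 2) (2 : ℤ)).subtype (fun _ _ ↦ rfl) x) ∈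
          localKummerOverOfEmb W 2 κ.kerSubgroup (closureEmb (K := ℚ) (v.adicCompletion ℚ))
            (⨆ n : ℕ, signedLocalPoints κ (v.adicCompletion ℚ) W 1 n))}.ncard ^ 2 =
  {y : subgroupH1 (κ.kerSubgroup ⊓ N) ↥(torsionBy ↥(W.geomPrimaryTorsion 2) (2 : ℤ)) |
      y ∈ unramifiedOutside (κ.kerSubgroup ⊓ N) ↥(torsionBy ↥(W.geomPrimaryTorsion 2) (2 : ℤ)) 2
            (↑S₀ : Set (HeightOneSpectrum (𝓞 ℚ))) ∧
      (∀ σ : absoluteGaloisGroup ℚ,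
        W.conjH1 2 (κ.kerSubgroup ⊓ N) σ
          (pushH1 (κ.kerSubgroup ⊓ N) (torsionBy ↥(W.geomPrimaryTorsion 2) (2 : ℤ)).subtype (fun _ _ ↦ rfl) y) ∈
          localKummerOverOfEmb W 2 (κ.kerSubgroup ⊓ N) ι' (⨆ n : ℕ, signedLocalPointsOfEmb κ ι' W 1 n))}.ncard

end Summit.BirchSwinnertonDyer.BirchSwinnertonDyer.Cruxes.ResidualThetaCountLowerPureAtTwo.SketchC1g5

end
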